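import Summits.ResolutionOfSingularities.ResolutionOfSingularities.Theorems.CoefficientCutTangency
import Summits.ResolutionOfSingularities.ResolutionOfSingularities.Theorems.CoefficientCutClasses
import HarnessLib

/-!
# MaxContactCutCoefficientCut — decomp-res node «CoefficientCut» (lens-5 g19 rev 1) refining the MaxContactCut
aside 31770; tree file 4/4 of the node

Content VERBATIM from the decomp-res lens-5 g19 file `HOME/decomp-res-lens-5/g19/CoefficientCut.lean` rev 1 (sha256
e823b9913123731a ≡
`parts/CoefficientCut-NODE-rev1-e823b991.lean`, 759 l; statements identical to the graded NODE pin e42372fd).  HOME =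
run/shared/lean/pub/decomp-res.  Critic: CRITIC-LEDGER rows 135 / 135a CLEARED (DECIDED-MOD-PORT(KNOWN) +1 · MAP
+1), landing orders
2026-08-30T19:29:50Z / 19:36:14Z.  Host: route `MaxContactCut`, aside 31770 `MaxContactCut.DefectWalksDeep` BY NAME
through the tree's
`ExitLaw.defectWalksDeep_iff_joint'` and the lens-5 g18 node `Theorems/PlanarCut*` + `MaxContactCutPlanarCut`.

Inside the Theses cone: §4 THE CLASSES AND THE NODE EQUATION — PIECE 1 `NoMonomialPlanarJointTailsDeep` (PORT,
lens letters), the necessities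
`planar_of_joint` / `skew_of_joint` / `monomial_of_planar`, the EXACT split `joint_iff_planar_skew`, THE KERNEL REDUCTION
`noPlanarJointTails_of_monomial` and `planar_iff_monomial` (the planar window is DECIDED modulo the port), the node equation
`joint_iff_monomial_skew` (hypothesis-free), `closes` (31770 BY NAME), `defectWalksDeep_iff_monomial_skew` (EXACT),
necessities of the pieces,
`skew_of_nonComponentPlanar`, `profile_of_monomialPlanar`; §4w the writer's EXACT link to the cone-free aside
classes of `CoefficientCutClasses`
(`sm_eq_zero_iff_isMonomialLed`, `monomialPlanar_iff_monomialLed`, `closes_led`, `defectWalksDeep_iff_led_skew`).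
PIECE 1′ and PIECE 2 themselves
live (VERBATIM) in `CoefficientCutClasses`, same namespace.

[WRITER NOTE (decomp-res writer g7): split by the critic's order into `CoefficientCutClasses` (CONE-FREE: the two
classes whose binders use
only tree-free vocabulary — `NoPlanarJointTailsDeep`, `NoSkewJointTailsDeep` VERBATIM — plus the writer's
cone-free restatement
`NoMonomialLedPlanarJointTailsDeep` of PIECE 1 with the PlanarCut letters `sm (layer k a F) i j = 0` spelled out as
`IsMonomialLed`, so that
the route file can import the two asides; the in-cone wiring file proves the restatement EXACT:
`monomialPlanar_iff_monomialLed`),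
`CoefficientCutLaws` (§1–§3, PROVED, imports `MaxContactCutPlanarCut`), `CoefficientCutTangency` (§3b, PROVED)
and `MaxContactCutCoefficientCut`
(§4 VERBATIM: PIECE 1 `NoMonomialPlanarJointTailsDeep` in the lens's letters, the node equation, `closes`, the
exact cut, necessities — plus the
writer's link §4w).  ONE namespace `…Theorems.CoefficientCut` as in the lens; global `set_option` line dropped;
nothing else changed.]

(Sources: BenitoVillamayor2012 Thm. 2.11, Thm. 3.3, §4; KawanoueMatsuki2016 §4–§5 (arXiv:1205.4556 pp. 2, 5,
7); Hauser2010 §§D–G; HauserPerlega2019; CossartJannsenSaito2020 Thm. 2.14; CossartPiltant2019; Moh1987.)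
-/

noncomputable section

open MvPolynomial Finset
open Literature.AlgebraicGeometry.Resolution
open Literature.AlgebraicGeometry.Resolution.Hauser2010
open Literature.AlgebraicGeometry.Resolution.PointBlowup
open Literature.AlgebraicGeometry.Resolution.WeightedBlowup
open Summit.ResolutionOfSingularities.ResolutionOfSingularities.Theses
open Summit.ResolutionOfSingularities.ResolutionOfSingularities.Theorems.TightDefectClasses
open Summit.ResolutionOfSingularities.ResolutionOfSingularities.Theorems.TightDefectStrongWalks
open Summit.ResolutionOfSingularities.ResolutionOfSingularities.Theorems.ItineraryCutClasses
open Summit.ResolutionOfSingularities.ResolutionOfSingularities.Theorems.BoundaryLedger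
open Summit.ResolutionOfSingularities.ResolutionOfSingularities.Theorems.ProximityCut
open Summit.ResolutionOfSingularities.ResolutionOfSingularities.Theorems.ExitLaw
open Summit.ResolutionOfSingularities.ResolutionOfSingularities.Theorems.PlanarCut

namespace Summit.ResolutionOfSingularities.ResolutionOfSingularities.Theorems.CoefficientCut

/-! ## §4 The classes: the MONOMIAL PLANAR CASE (port, printed), ALL planar tails (decided modulo the port), the
SKEW residual (located), and the EXACT relocation of the tree's joint residual -/

section Classes

/-- PIECE 1 · PORT · **THE MONOMIAL PLANAR CASE** · tags: COSTUME(cite: BenitoVillamayor2012 = Math. Ann. 353,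
arXiv:1103.3464, Thm 2.11 (p. 8) + §4 cases A–D2 (pp. 12–17), `d = 3`; KawanoueMatsuki2016 = arXiv:1205.4556: p. 2
(«an algorithm for resolution of singularities of an idealistic filtration in dimension 3 (at the local level) in
positive characteristic»; perfect ground field by Galois descent), p. 5 (the output: `Sing = ∅` after finitely many
transformations), p. 7 (the `τ = 1` monomial case), §4–§5; the model ↔ scheme dictionary below IS the port, memo
`PORT.md`) · WEAKER(evidence: a SUB-CASE of the joint residual
BY LETTER — `monomial_of_planar ∘ planar_of_joint` — and not known to imply it: `bc/Probe.lean` P1 must-fail) ·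
leaf: ATTACKABLE (type the dictionary: restriction functor `F ↦ (G⁽ᵃ⁾)_a` + B–V's monomial-case invariant on layer
`0`) ∧ INSTRUMENTABLE (its kernel PROFILE LAWS `profile_of_monomialPlanar` are replayable on every planar translated
excess move of the census beds; ask T-planar-7a).
No deep defect walk (the joint residual's binders VERBATIM: eventual shade plateau, eventual excess, infinitely many
proximity repeats, infinitely many translated moves) has a PLANAR tail along a plane `u_k = 0` (never the chart,
never a `u_k`-translation, from `N` on) that does NOT divide `F_t` (layer `0` non-empty at every `t ≥ N`) and all
of whose POSITIVE wall layers `1 … q−1` are MONOMIAL-LED from `N` on (`sm = 0`).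
DICTIONARY (the coefficient datum).  Along such a tail the walk never leaves the regular hypersurface germ
`H = {u_k = 0}` of the ambient `(u_i,u_j,u_k)`-3-fold; restricted to `H`, the tower is the sequence of closed-point
blow-ups of the Rees algebra / idealistic filtration generated over the regular SURFACE germ `(u_i,u_j)` by ONE
`p^e`-presentation `(Z^q + G⁽⁰⁾, q)` (`G⁽⁰⁾ = F|_H`, elimination variable `Z`, `τ ≥ 1`) and the coefficient marks
`(G⁽ᵃ⁾, q − a)`, `G⁽ᵃ⁾ = coeff_{u_k^a} F` = layer `a` (the layers transform INDEPENDENTLY under planar moves: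
`PlanarCut.coeff_pointTransform_planar` = the controlled transform with mark `q − a`; cleaning rewrites the SAME
generator `(Z'+g)^q + (G' − g^q) = Z'^q + G'`; `Sing` of the restricted datum = `Sing ∩ H`) — with the marks
`(G⁽ᵃ⁾, q−a)` already MONOMIAL: an instance of the printed dimension-three theorems (B–V 2012 Thm 2.11 + 3.3 + §4,
`d = 3 → d' = 2`; K–M arXiv:1205.4556 §4–§5, the local algorithm in dimension 3), whose centre through an isolated
singular point is that point (`ForcedWalk.isolated`), and whose termination forbids an infinite chain of singular
germs, a fortiori one with constant shade and permanent excess.  Strictly inside print; strictly below the open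
two-`p`-polynomial problem `MaxContactCut.RungTwo`
(dimension 4, `τ ≥ 2`): here ONE genuine `p^e`-polynomial over a surface.  NOT CLAIMED: that the forced walk of the
model is VERBATIM a run of either printed algorithm — that identification is the port. -/
def NoMonomialPlanarJointTailsDeep : Prop :=
  ∀ p : ℕ, p.Prime → ∀ e : ℕ, 2 ≤ e → ∀ (K : Type) [Field K] [CharP K p] [PerfectField K] [DecidableEq K]
    (s₀ : State (Fin 3) K), IsRoot (p ^ e) s₀ → ∀ W : ForcedWalk (p ^ e) s₀, (∀ i, 1 ≤ (W.st i).shade) →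
    ∀ N : ℕ, (∀ t, N ≤ t → (W.st (t + 1)).shade = (W.st t).shade) →
    (∀ t, N ≤ t → ordZero (W.st t).F ≠ ((p ^ e : ℕ) : ℕ∞)) →
    (∀ M : ℕ, ∃ t, M ≤ t ∧ StaysOnNewest W t) → (∀ M : ℕ, ∃ t, M ≤ t ∧ W.b t ≠ 0) →
    ∀ (i j k : Fin 3), i ≠ j → j ≠ k → i ≠ k → (∀ t, N ≤ t → W.j t ≠ k ∧ W.b t k = 0) →
    (∀ t, N ≤ t → ∃ d ∈ (W.st t).F.support, d k = 0) →
    (∀ t, N ≤ t → ∀ a, 1 ≤ a → a < p ^ e → sm (layer k a (W.st t).F) i j = 0) → False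

/-- NECESSITY: the planar window is a sub-case of the joint residual. [folklore] -/
theorem planar_of_joint (h : NoRepeatTranslationRecurrentExcessPlateauxDeep) : NoPlanarJointTailsDeep :=
  fun p hp e he K _ _ _ _ s₀ hs W hsh N hpl hex hS hb _ _ _ => h p hp e he K s₀ hs W hsh N hpl hex hS hb

/-- NECESSITY: the skew residual is a sub-case of the joint residual. [folklore] -/
theorem skew_of_joint (h : NoRepeatTranslationRecurrentExcessPlateauxDeep) : NoSkewJointTailsDeep :=
  fun p hp e he K _ _ _ _ s₀ hs W hsh N hpl hex hS hb _ => h p hp e he K s₀ hs W hsh N hpl hex hS hb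

/-- NECESSITY: the monomial planar case is a sub-case of the planar window (hence of the joint residual, hence of
the host target). [folklore] -/
theorem monomial_of_planar (h : NoPlanarJointTailsDeep) : NoMonomialPlanarJointTailsDeep :=
  fun p hp e he K _ _ _ _ s₀ hs W hsh N hpl hex hS hb _ _ k _ _ _ hP _ _ =>
    h p hp e he K s₀ hs W hsh N hpl hex hS hb k N hP

/-- **EXACT SPLIT (PROVED, hypothesis-free):** joint residual `⟺` planar window `∧` skew residual (excluded middle on
«some planar tail exists»). [new] [folklore] -/
theorem joint_iff_planar_skew :
    NoRepeatTranslationRecurrentExcessPlateauxDeep ↔ NoPlanarJointTailsDeep ∧ NoSkewJointTailsDeep := by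
  refine ⟨fun h => ⟨planar_of_joint h, skew_of_joint h⟩, fun ⟨hPl, hSk⟩ => ?_⟩
  intro p hp e he K _ _ _ _ s₀ hs W hsh N hpl hex hS hb
  by_cases hex' : ∃ (k : Fin 3) (N' : ℕ), ∀ t, N' ≤ t → W.j t ≠ k ∧ W.b t k = 0
  · obtain ⟨k, N', hP⟩ := hex'
    exact hPl p hp e he K s₀ hs W hsh N hpl hex hS hb k N' hP
  · push Not at hex'
    refine hSk p hp e he K s₀ hs W hsh N hpl hex hS hb fun k N' => ?_
    obtain ⟨t, ht, h⟩ := hex' k N'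
    refine ⟨t, ht, ?_⟩
    by_cases hj : W.j t = k
    · exact Or.inl hj
    · exact Or.inr (h hj)

/-- **THE KERNEL REDUCTION (PROVED): the monomial planar case decides ALL planar tails of the joint residual.**
Given a planar tail along `u_k = 0` from `N'`: either layer `0` of the wall is empty at some `t ≥ N'` — then the
wall divides `F_t` and the tree's component-form planar law `PlanarCut.noPlanarTails_of_layer_zero` ends the walk —
or layer `0` is non-empty for ever, and the positive potential dies at the repeats (`exists_dead_pos`): from some
`T` on the tail is in the MONOMIAL REGIME, which is the port's case. [new] [folklore] -/
theorem noPlanarJointTails_of_monomial (hM : NoMonomialPlanarJointTailsDeep) : NoPlanarJointTailsDeep := by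
  intro p hp e he K _ _ _ _ s₀ hs W hsh N hpl hex hS hb k N' hP
  classical
  by_cases h0 : ∃ t, N' ≤ t ∧ layer k 0 (W.st t).F = ∅
  · obtain ⟨t, ht, h0t⟩ := h0
    exact noPlanarTails_of_layer_zero hs W k t (fun t' ht' => hP t' (le_trans ht ht')) h0t hS hb
  · push Not at h0
    -- pick the two plane coordinates `i ≠ j`, both `≠ k`
    obtain ⟨i, hik⟩ := exists_ne k
    obtain ⟨j, hji, hjk⟩ := fin3_third i k hik
    have hij : i ≠ j := fun h => hji h.symm
    obtain ⟨T, hNT, hdead⟩ := exists_dead_pos hij hjk hik hs W hP hS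
    refine hM p hp e he K s₀ hs W hsh (max T N) (fun t ht => hpl t (le_of_max_le_right ht))
      (fun t ht => hex t (le_of_max_le_right ht)) hS hb i j k hij hjk hik
      (fun t ht => hP t (le_trans hNT (le_of_max_le_left ht))) (fun t ht => ?_)
      (fun t ht a ha1 haq => hdead t (le_of_max_le_left ht) a ha1 haq)
    obtain ⟨d, hd⟩ := h0 t (le_trans hNT (le_of_max_le_left ht))
    rw [mem_layer] at hd
    exact ⟨d, MvPolynomial.mem_support_iff.mpr hd.1, hd.2⟩

/-- **EXACT:** the planar window `⟺` the monomial planar case. [new] [folklore] -/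
theorem planar_iff_monomial : NoPlanarJointTailsDeep ↔ NoMonomialPlanarJointTailsDeep :=
  ⟨monomial_of_planar, noPlanarJointTails_of_monomial⟩

/-- **THE NODE EQUATION (PROVED, hypothesis-free, EXACT): joint residual `⟺` monomial planar case `∧` skew
residual.** [new] [folklore] -/
theorem joint_iff_monomial_skew :
    NoRepeatTranslationRecurrentExcessPlateauxDeep ↔ NoMonomialPlanarJointTailsDeep ∧ NoSkewJointTailsDeep := by
  rw [joint_iff_planar_skew, planar_iff_monomial]

/-- The joint residual `⟺` the skew residual, GIVEN the monomial planar case. [new] [folklore] -/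
theorem joint_iff_skew_of_monomial (hM : NoMonomialPlanarJointTailsDeep) :
    NoRepeatTranslationRecurrentExcessPlateauxDeep ↔ NoSkewJointTailsDeep := by
  rw [joint_iff_monomial_skew]
  exact ⟨fun h => h.2, fun h => ⟨hM, h⟩⟩

/-- **`closes`: THE HOST TARGET (tree joint residual, via `ExitLaw.defectWalksDeep_iff_joint'`) FROM THE PIECES
(PROVED):** deep arc law (decided in the tree's desk sense; hypothesis exactly as in `PlanarCut.closes`) `∧`
monomial planar case (PORT) `∧` skew residual (LOCATED) `⟹ MaxContactCut.DefectWalksDeep` (= 31770 by name).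
[new] [folklore] -/
theorem closes (hA : NoFreePointTailsDeep) (hM : NoMonomialPlanarJointTailsDeep) (hR : NoSkewJointTailsDeep) :
    MaxContactCut.DefectWalksDeep :=
  defectWalksDeep_iff_joint'.mpr ⟨hA, joint_iff_monomial_skew.mpr ⟨hM, hR⟩⟩

/-- `closes` at the level of the joint residual itself (no arc-law hypothesis). [new] [folklore] -/
theorem closes_joint (hM : NoMonomialPlanarJointTailsDeep) (hR : NoSkewJointTailsDeep) :
    NoRepeatTranslationRecurrentExcessPlateauxDeep :=
  joint_iff_monomial_skew.mpr ⟨hM, hR⟩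

/-- THE EXACT CUT of the host target down to the pieces. [new] [folklore] -/
theorem defectWalksDeep_iff_monomial_skew : MaxContactCut.DefectWalksDeep ↔
    NoFreePointTailsDeep ∧ NoMonomialPlanarJointTailsDeep ∧ NoSkewJointTailsDeep := by
  rw [defectWalksDeep_iff_joint', joint_iff_monomial_skew]

/-- NECESSITY: each piece is implied by the host target. [folklore] -/
theorem monomial_of_defectWalksDeep (h : MaxContactCut.DefectWalksDeep) : NoMonomialPlanarJointTailsDeep :=
  (defectWalksDeep_iff_monomial_skew.mp h).2.1

/-- NECESSITY: each piece is implied by the host target. [folklore] -/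
theorem skew_of_defectWalksDeep (h : MaxContactCut.DefectWalksDeep) : NoSkewJointTailsDeep :=
  (defectWalksDeep_iff_monomial_skew.mp h).2.2

/-- Comparison with the tree's located residual (lens-5 g18 rev 1): the skew residual is implied by
`PlanarCut.NoNonComponentPlanarRepeatTranslationRecurrentExcessPlateauxDeep` (which is `≡` the joint residual). [folklore] -/
theorem skew_of_nonComponentPlanar (h : NoNonComponentPlanarRepeatTranslationRecurrentExcessPlateauxDeep) :
    NoSkewJointTailsDeep :=
  skew_of_joint (joint_iff_nonComponentPlanar.mpr h)

/-- **THE PROFILE LAWS OF THE PORT'S CLASS (PROVED, hypothesis-free):** in the monomial planar regime, at every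
translated move `t ≥ N` the old layer `0` has an exponent of degree `< 2q` (so `ord₀ F_t < 2q`) and the new layer `0`
has an exponent with `d_{j_t} < q`.  (These are the kernel's share of the printed invariant analysis, which starts
from `q ≤ ord G⁽⁰⁾ < 2q` at the points to be resolved.) [new] [folklore] -/
theorem profile_of_monomialPlanar :
    ∀ p : ℕ, p.Prime → ∀ e : ℕ, 2 ≤ e → ∀ (K : Type) [Field K] [CharP K p] [PerfectField K] [DecidableEq K]
    (s₀ : State (Fin 3) K), IsRoot (p ^ e) s₀ → ∀ W : ForcedWalk (p ^ e) s₀,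
    ∀ (N : ℕ) (i j k : Fin 3), i ≠ j → j ≠ k → i ≠ k → (∀ t, N ≤ t → W.j t ≠ k ∧ W.b t k = 0) →
    (∀ t, N ≤ t → ∀ a, 1 ≤ a → a < p ^ e → sm (layer k a (W.st t).F) i j = 0) →
    ∀ t, N ≤ t → W.b t ≠ 0 →
      (∃ d ∈ (W.st t).F.support, d k = 0 ∧ d.degree < 2 * p ^ e) ∧
      ordZero (W.st t).F < ((2 * p ^ e : ℕ) : ℕ∞) ∧
      (∃ d ∈ (W.st (t + 1)).F.support, d k = 0 ∧ d (W.j t) < p ^ e) := by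
  intro p hp e he K _ _ _ _ s₀ hs W N i j k hij hjk hik hP hdead t ht hbt
  exact ⟨layer_zero_low_at_translated hij hjk hik hs W hP le_rfl hdead ht hbt,
    ordZero_lt_at_translated hij hjk hik hs W hP le_rfl hdead ht hbt,
    layer_zero_thin_after_translated hij hjk hik hs W hP le_rfl hdead ht hbt⟩

end Classes

/-! ## §4w (writer g7 · PROVED) the cone-free letters are EXACT: `sm = 0` iff monomial-led; PIECE 1 iff its cone-free
restatement; `closes` and the exact cut through the asides' home classes (`CoefficientCutClasses`) -/

section Link

/-- The PlanarCut strict multiplicity vanishes iff the exponent set is monomial-led (empty, or with a componentwise least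
element in `(d_i, d_j)`). [folklore] -/
theorem sm_eq_zero_iff_isMonomialLed (S : Finset (Fin 3 →₀ ℕ)) (i j : Fin 3) :
    sm S i j = 0 ↔ IsMonomialLed S i j := by
  unfold IsMonomialLed
  by_cases hS : S.Nonempty
  · constructor
    · intro h
      right
      obtain ⟨d, hd, hdsum⟩ := exists_loSum_eq hS i j
      have h1 := lo_le hd i
      have h2 := lo_le hd j
      have hsm : loSum S i j ≤ lo S i + lo S j := by unfold sm at h; omega
      refine ⟨d, hd, fun d' hd' => ?_⟩
      have h1' := lo_le hd' i
      have h2' := lo_le hd' j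
      constructor <;> omega
    · rintro (h | ⟨d, hd, hmin⟩)
      · exact absurd h hS.ne_empty
      · have h3 := loSum_le hd i j
        obtain ⟨d₁, hd₁, e₁⟩ := exists_lo_eq hS i
        obtain ⟨d₂, hd₂, e₂⟩ := exists_lo_eq hS j
        have h4 := (hmin d₁ hd₁).1
        have h5 := (hmin d₂ hd₂).2
        unfold sm
        omega
  · rw [Finset.not_nonempty_iff_eq_empty] at hS
    subst hS
    refine ⟨fun _ => Or.inl rfl, fun _ => ?_⟩
    unfold sm PlanarCut.lo PlanarCut.loSum
    simp

/-- **EXACT (writer g7):** PIECE 1 in the lens's PlanarCut letters `⟺` its cone-free restatement in `CoefficientCutClasses`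
(`PlanarCut.layer k a F` is by definition `F.support.filter (· k = a)`; `sm = 0 ↔ IsMonomialLed`). [folklore] -/
theorem monomialPlanar_iff_monomialLed :
    NoMonomialPlanarJointTailsDeep ↔ NoMonomialLedPlanarJointTailsDeep := by
  constructor
  · intro h p hp e he K _ _ _ _ s₀ hs W hsh N hpl hex hS hb i j k hij hjk hik hP h0 hled
    exact h p hp e he K s₀ hs W hsh N hpl hex hS hb i j k hij hjk hik hP h0
      (fun t ht a ha1 haq => (sm_eq_zero_iff_isMonomialLed (layer k a (W.st t).F) i j).mpr (hled t ht a ha1 haq))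
  · intro h p hp e he K _ _ _ _ s₀ hs W hsh N hpl hex hS hb i j k hij hjk hik hP h0 hdead
    exact h p hp e he K s₀ hs W hsh N hpl hex hS hb i j k hij hjk hik hP h0
      (fun t ht a ha1 haq => (sm_eq_zero_iff_isMonomialLed (layer k a (W.st t).F) i j).mp (hdead t ht a ha1 haq))

/-- `closes` through the asides' home classes (cone-free PIECE 1 + PIECE 2): deep arc law `∧` monomial-led planar case (PORT)
`∧` skew residual (LOCATED) `⟹ MaxContactCut.DefectWalksDeep` (31770 BY NAME). [folklore] -/
theorem closes_led (hA : NoFreePointTailsDeep) (hM : NoMonomialLedPlanarJointTailsDeep) (hR : NoSkewJointTailsDeep) :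
    MaxContactCut.DefectWalksDeep :=
  closes hA (monomialPlanar_iff_monomialLed.mpr hM) hR

/-- THE EXACT CUT of the host target down to the asides' home classes. [folklore] -/
theorem defectWalksDeep_iff_led_skew : MaxContactCut.DefectWalksDeep ↔
    NoFreePointTailsDeep ∧ NoMonomialLedPlanarJointTailsDeep ∧ NoSkewJointTailsDeep := by
  rw [defectWalksDeep_iff_monomial_skew, monomialPlanar_iff_monomialLed]

/-- NECESSITY of the cone-free PIECE 1. [folklore] -/
theorem monomialLed_of_defectWalksDeep (h : MaxContactCut.DefectWalksDeep) : NoMonomialLedPlanarJointTailsDeep :=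
  (defectWalksDeep_iff_led_skew.mp h).2.1

end Link

end Summit.ResolutionOfSingularities.ResolutionOfSingularities.Theorems.CoefficientCut
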